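import Summits.Parity.GeneralizedHardyLittlewood.Theorems.PrimeLevelFamEdgeMomentsBeyondDiagonalDiagRemRademacher
import HarnessLib

/-!
# Route `PrimeLevelFamEdge`, crux K_A `MomentsBeyondDiagonal` (stmt-Parity-20007), line «petersson_layers» v4, stub `stub_diag`:
# **the Rademacher identities up to order 8: `Σ_{de=k}(log d − log e)^r = τ(k)·m_r(k)` on squarefree `k`,
# `m₆ = 15P₂³ − 30P₂P₄ + 16P₆`, `m₈ = 105P₂⁴ − 420P₂²P₄ + 448P₂P₆ + 140P₄² − 272P₈`** (sequel of `…DiagRemRademacher`)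

The bridge between the generic tail theorem `…DiagRemMomentTailBoundPow.abs_sum_Wn_logDiff_pow_sub_le_pow` («DRTAIL»_r, stated with
`S_r(k) = Σ_{de=k}(log d − log e)^r`) and the central-moment kinds `X = 𝔼D⁶`, `Z = 𝔼D⁸` of the order-`(i,j)` remainder weight tables
(`Cruxes/…/Lines/petersson_layers_stub_diag_g16_order44.md`): on squarefree `k`, `S_r(k) = τ(k)·𝔼[(Σ_{p∣k}ε_p log p)^r]`, and the even
moments are the listed polynomials in `P_j(k) = Σ_{p∣k}logʲp` (cumulants `κ_{2j} = (1, −2, 16, −272)·P_{2j}`). Same induction as the `r ≤ 4` file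
(multiplicativity of `S = E ∗ E⁻`, prime values `((log p)^r + (−log p)^r)/r!`), carried to `r ≤ 8`.

* `sum_divisorsAntidiagonal_log_sub_pow_six_eight_of_squarefree` — the identities for `r = 6, 8` (and `S₅ = S₇ = 0`);
* `copTauW_mul_decorSix_eq`, `copTauW_mul_decorEight_eq` — `a_n(k)·m_r(k) = W_n(k)·S_r(k)` for every `k`, `r = 6, 8`.

Def-free; theorems only; elementary. Helper `--supports stmt-Parity-20007`; closes nothing; K_A, K_B and the Parity summit are NOT
proved; nothing about Landau–Siegel zeros.

## References
* E. Kowalski, P. Michel, J. VanderKam, J. reine angew. Math. 526 (2000), Prop. 5.1 p. 18.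
  [cite: KowalskiMichelVanderKam2000, Prop. 5.1 — derivation (decorated Selberg coefficients)]
-/

noncomputable section

open Finset Real ArithmeticFunction

namespace Summit.Parity.GeneralizedHardyLittlewood.Theorems.MomentsBeyondDiagonal.DiagCorner

open Literature.NumberTheory.LFunctions.KMV2000.MollifierMainTerm (W)
open Summit.Parity.GeneralizedHardyLittlewood.Theorems.BeyondDiagonalBeatsQuarter.KernelFormXSq
  (copTauW copTauW_apply W_eq_zero_of_not_squarefree)

set_option maxHeartbeats 3200000 in
/-- **The Rademacher identities for `r = 5, 6, 7, 8` on squarefree `k`**: `Σ_{de=k}(log d − log e)^r = 0, τ(k)m₆(k), 0, τ(k)m₈(k)`.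
[folklore] -/
theorem sum_divisorsAntidiagonal_log_sub_pow_six_eight_of_squarefree (k : ℕ) (hk : Squarefree k) :
    (∑ x ∈ k.divisorsAntidiagonal, (Real.log x.1 - Real.log x.2) ^ 5) = 0 ∧
    (∑ x ∈ k.divisorsAntidiagonal, (Real.log x.1 - Real.log x.2) ^ 6) = (k.divisors.card : ℝ) * (15 * (∑ p ∈ k.primeFactors, Real.log p ^ 2) ^ 3 - 30 * (∑ p ∈ k.primeFactors, Real.log p ^ 2) * (∑ p ∈ k.primeFactors, Real.log p ^ 4) + 16 * ∑ p ∈ k.primeFactors, Real.log p ^ 6) ∧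
    (∑ x ∈ k.divisorsAntidiagonal, (Real.log x.1 - Real.log x.2) ^ 7) = 0 ∧
    (∑ x ∈ k.divisorsAntidiagonal, (Real.log x.1 - Real.log x.2) ^ 8) = (k.divisors.card : ℝ) * (105 * (∑ p ∈ k.primeFactors, Real.log p ^ 2) ^ 4 - 420 * (∑ p ∈ k.primeFactors, Real.log p ^ 2) ^ 2 * (∑ p ∈ k.primeFactors, Real.log p ^ 4) + 448 * (∑ p ∈ k.primeFactors, Real.log p ^ 2) * (∑ p ∈ k.primeFactors, Real.log p ^ 6) + 140 * (∑ p ∈ k.primeFactors, Real.log p ^ 4) ^ 2 - 272 * ∑ p ∈ k.primeFactors, Real.log p ^ 8) := by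
  classical
  set E : ArithmeticFunction (PowerSeries ℝ) :=
    ⟨fun d ↦ if d = 0 then 0 else PowerSeries.rescale (1 * Real.log d) (PowerSeries.exp ℝ), if_pos rfl⟩ with hEdef
  set Em : ArithmeticFunction (PowerSeries ℝ) :=
    ⟨fun d ↦ if d = 0 then 0 else PowerSeries.rescale (-1 * Real.log d) (PowerSeries.exp ℝ), if_pos rfl⟩ with hEmdef
  have hE : ∀ d : ℕ, d ≠ 0 → E d = PowerSeries.rescale (1 * Real.log d) (PowerSeries.exp ℝ) := fun d hd ↦ by
    rw [hEdef]; exact if_neg hd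
  have hEm : ∀ d : ℕ, d ≠ 0 → Em d = PowerSeries.rescale (-1 * Real.log d) (PowerSeries.exp ℝ) := fun d hd ↦ by
    rw [hEmdef]; exact if_neg hd
  have hS : (E * Em).IsMultiplicative := (isMultiplicative_expWeight 1 E hE).mul (isMultiplicative_expWeight (-1) Em hEm)
  have hT : ∀ k r : ℕ, ∑ x ∈ k.divisorsAntidiagonal, (Real.log x.1 - Real.log x.2) ^ r =
      (r.factorial : ℝ) * PowerSeries.coeff r ((E * Em) k) := by
    intro k r
    rw [coeff_symmKernel E Em hE hEm k r, Finset.mul_sum]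
    refine Finset.sum_congr rfl fun x _ ↦ ?_
    have : (r.factorial : ℝ) ≠ 0 := by positivity
    field_simp
  have hprime : ∀ p : ℕ, p.Prime → ∀ r : ℕ, PowerSeries.coeff r ((E * Em) p) =
      ((Real.log p) ^ r + (-Real.log p) ^ r) / (r.factorial : ℝ) := by
    intro p hp r
    rw [coeff_symmKernel E Em hE hEm p r, Nat.sum_divisorsAntidiagonal (fun d e ↦ (Real.log d - Real.log e) ^ r / (r.factorial : ℝ)),
      Nat.Prime.divisors hp, Finset.sum_pair hp.one_lt.ne, Nat.div_one, Nat.div_self hp.pos]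
    simp only [Nat.cast_one, Real.log_one, zero_sub, sub_zero]
    ring
  suffices H : Squarefree k →
    PowerSeries.coeff 0 ((E * Em) k) = (k.divisors.card : ℝ) ∧
    PowerSeries.coeff 1 ((E * Em) k) = 0 ∧
    PowerSeries.coeff 2 ((E * Em) k) = (k.divisors.card : ℝ) * (∑ p ∈ k.primeFactors, Real.log p ^ 2) / 2 ∧
    PowerSeries.coeff 3 ((E * Em) k) = 0 ∧
    PowerSeries.coeff 4 ((E * Em) k) = (k.divisors.card : ℝ) * (3 * (∑ p ∈ k.primeFactors, Real.log p ^ 2) ^ 2 - 2 * ∑ p ∈ k.primeFactors, Real.log p ^ 4) / 24 ∧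
    PowerSeries.coeff 5 ((E * Em) k) = 0 ∧
    PowerSeries.coeff 6 ((E * Em) k) = (k.divisors.card : ℝ) * (15 * (∑ p ∈ k.primeFactors, Real.log p ^ 2) ^ 3 - 30 * (∑ p ∈ k.primeFactors, Real.log p ^ 2) * (∑ p ∈ k.primeFactors, Real.log p ^ 4) + 16 * ∑ p ∈ k.primeFactors, Real.log p ^ 6) / 720 ∧
    PowerSeries.coeff 7 ((E * Em) k) = 0 ∧
    PowerSeries.coeff 8 ((E * Em) k) = (k.divisors.card : ℝ) * (105 * (∑ p ∈ k.primeFactors, Real.log p ^ 2) ^ 4 - 420 * (∑ p ∈ k.primeFactors, Real.log p ^ 2) ^ 2 * (∑ p ∈ k.primeFactors, Real.log p ^ 4) + 448 * (∑ p ∈ k.primeFactors, Real.log p ^ 2) * (∑ p ∈ k.primeFactors, Real.log p ^ 6) + 140 * (∑ p ∈ k.primeFactors, Real.log p ^ 4) ^ 2 - 272 * ∑ p ∈ k.primeFactors, Real.log p ^ 8) / 40320 by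
    obtain ⟨-, -, -, -, -, h5, h6, h7, h8⟩ := H hk
    refine ⟨?_, ?_, ?_, ?_⟩
    · rw [hT, h5]; simp
    · rw [hT, h6]; norm_num [Nat.factorial]; ring
    · rw [hT, h7]; simp
    · rw [hT, h8]; norm_num [Nat.factorial]; ring
  clear hk
  induction k using induction_on_primes with
  | zero => intro h0; exact absurd h0 not_squarefree_zero
  | one =>
    intro _
    have h1 : ∀ r : ℕ, PowerSeries.coeff r ((E * Em) 1) = (0 : ℝ) ^ r / (r.factorial : ℝ) := by
      intro r
      rw [coeff_symmKernel E Em hE hEm 1 r, Nat.divisorsAntidiagonal_one, Finset.sum_singleton]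
      simp
    rw [h1 0, h1 1, h1 2, h1 3, h1 4, h1 5, h1 6, h1 7, h1 8, Nat.divisors_one, Nat.primeFactors_one]
    norm_num
  | prime_mul p a hp ih =>
    intro hsq
    have hcop : Nat.Coprime p a := Nat.coprime_of_squarefree_mul hsq
    have hpa : ¬ p ∣ a := fun hdvd ↦ hp.ne_one (Nat.Coprime.eq_one_of_dvd hcop hdvd)
    have ha : Squarefree a := hsq.of_mul_right
    have ha0 : a ≠ 0 := ha.ne_zero
    obtain ⟨i0, i1, i2, i3, i4, i5, i6, i7, i8⟩ := ih ha
    have hmul : (E * Em) (p * a) = (E * Em) p * (E * Em) a := hS.map_mul_of_coprime hcop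
    have hτ : ((p * a).divisors.card : ℝ) = 2 * (a.divisors.card : ℝ) := by
      rw [Nat.Coprime.card_divisors_mul hcop, Nat.Prime.divisors hp, Finset.card_pair hp.one_lt.ne]
      push_cast; ring
    have hpf : (p * a).primeFactors = insert p a.primeFactors := by
      rw [Nat.primeFactors_mul hp.ne_zero ha0, Nat.Prime.primeFactors hp]; rfl
    have hpmem : p ∉ a.primeFactors := fun h ↦ hpa (Nat.dvd_of_mem_primeFactors h)
    have hP2 : ∑ q ∈ (p * a).primeFactors, Real.log q ^ 2 = Real.log p ^ 2 + ∑ q ∈ a.primeFactors, Real.log q ^ 2 := by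
      rw [hpf, Finset.sum_insert hpmem]
    have hP4 : ∑ q ∈ (p * a).primeFactors, Real.log q ^ 4 = Real.log p ^ 4 + ∑ q ∈ a.primeFactors, Real.log q ^ 4 := by
      rw [hpf, Finset.sum_insert hpmem]
    have hP6 : ∑ q ∈ (p * a).primeFactors, Real.log q ^ 6 = Real.log p ^ 6 + ∑ q ∈ a.primeFactors, Real.log q ^ 6 := by
      rw [hpf, Finset.sum_insert hpmem]
    have hP8 : ∑ q ∈ (p * a).primeFactors, Real.log q ^ 8 = Real.log p ^ 8 + ∑ q ∈ a.primeFactors, Real.log q ^ 8 := by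
      rw [hpf, Finset.sum_insert hpmem]
    have q0 := hprime p hp 0
    have q1 := hprime p hp 1
    have q2 := hprime p hp 2
    have q3 := hprime p hp 3
    have q4 := hprime p hp 4
    have q5 := hprime p hp 5
    have q6 := hprime p hp 6
    have q7 := hprime p hp 7
    have q8 := hprime p hp 8
    refine ⟨?_, ?_, ?_, ?_, ?_, ?_, ?_, ?_, ?_⟩
    · rw [hmul, PowerSeries.coeff_mul, Finset.Nat.sum_antidiagonal_eq_sum_range_succ_mk]
      simp only [Finset.sum_range_succ, Finset.sum_range_zero, zero_add, q0, i0, hτ]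
      norm_num [Nat.factorial]
    · rw [hmul, PowerSeries.coeff_mul, Finset.Nat.sum_antidiagonal_eq_sum_range_succ_mk]
      simp only [Finset.sum_range_succ, Finset.sum_range_zero, zero_add, q0, q1, i0, i1]
      ring
    · rw [hmul, PowerSeries.coeff_mul, Finset.Nat.sum_antidiagonal_eq_sum_range_succ_mk]
      simp only [Finset.sum_range_succ, Finset.sum_range_zero, zero_add, q0, q1, q2, i0, i1, i2, hτ, hP2]
      norm_num [Nat.factorial]
      ring
    · rw [hmul, PowerSeries.coeff_mul, Finset.Nat.sum_antidiagonal_eq_sum_range_succ_mk]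
      simp only [Finset.sum_range_succ, Finset.sum_range_zero, zero_add, q0, q1, q2, q3, i0, i1, i2, i3]
      ring
    · rw [hmul, PowerSeries.coeff_mul, Finset.Nat.sum_antidiagonal_eq_sum_range_succ_mk]
      simp only [Finset.sum_range_succ, Finset.sum_range_zero, zero_add, q0, q1, q2, q3, q4, i0, i1, i2, i3, i4, hτ, hP2, hP4]
      norm_num [Nat.factorial]
      ring
    · rw [hmul, PowerSeries.coeff_mul, Finset.Nat.sum_antidiagonal_eq_sum_range_succ_mk]
      simp only [Finset.sum_range_succ, Finset.sum_range_zero, zero_add, q0, q1, q2, q3, q4, q5, i0, i1, i2, i3, i4, i5]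
      ring
    · rw [hmul, PowerSeries.coeff_mul, Finset.Nat.sum_antidiagonal_eq_sum_range_succ_mk]
      simp only [Finset.sum_range_succ, Finset.sum_range_zero, zero_add, q0, q1, q2, q3, q4, q5, q6, i0, i1, i2, i3, i4, i5, i6, hτ, hP2, hP4, hP6]
      norm_num [Nat.factorial]
      ring
    · rw [hmul, PowerSeries.coeff_mul, Finset.Nat.sum_antidiagonal_eq_sum_range_succ_mk]
      simp only [Finset.sum_range_succ, Finset.sum_range_zero, zero_add, q0, q1, q2, q3, q4, q5, q6, q7, i0, i1, i2, i3, i4, i5, i6, i7]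
      ring
    · rw [hmul, PowerSeries.coeff_mul, Finset.Nat.sum_antidiagonal_eq_sum_range_succ_mk]
      simp only [Finset.sum_range_succ, Finset.sum_range_zero, zero_add, q0, q1, q2, q3, q4, q5, q6, q7, q8, i0, i1, i2, i3, i4, i5, i6, i7, i8, hτ, hP2, hP4, hP6, hP8]
      norm_num [Nat.factorial]
      ring

/-- **`a_n(k)·m₆(k) = W_n(k)·S₆(k)` for every `k`** (`m₆ = 15P₂³ − 30P₂P₄ + 16P₆`). [cite: KowalskiMichelVanderKam2000, Prop. 5.1 — derivation] -/
theorem copTauW_mul_decorSix_eq (n k : ℕ) :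
    copTauW n k * (15 * (∑ p ∈ k.primeFactors, Real.log p ^ 2) ^ 3 -
        30 * (∑ p ∈ k.primeFactors, Real.log p ^ 2) * (∑ p ∈ k.primeFactors, Real.log p ^ 4) +
          16 * ∑ p ∈ k.primeFactors, Real.log p ^ 6) =
      (if k.Coprime n then W k else 0) * ∑ x ∈ k.divisorsAntidiagonal, (Real.log x.1 - Real.log x.2) ^ 6 := by
  by_cases hk : Squarefree k
  · rw [copTauW_apply, (sum_divisorsAntidiagonal_log_sub_pow_six_eight_of_squarefree k hk).2.1]
    split_ifs <;> ring
  · rw [copTauW_apply, W_eq_zero_of_not_squarefree hk]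
    split_ifs <;> simp

/-- **`a_n(k)·m₈(k) = W_n(k)·S₈(k)` for every `k`** (`m₈ = 105P₂⁴ − 420P₂²P₄ + 448P₂P₆ + 140P₄² − 272P₈`).
[cite: KowalskiMichelVanderKam2000, Prop. 5.1 — derivation] -/
theorem copTauW_mul_decorEight_eq (n k : ℕ) :
    copTauW n k * (105 * (∑ p ∈ k.primeFactors, Real.log p ^ 2) ^ 4 -
        420 * (∑ p ∈ k.primeFactors, Real.log p ^ 2) ^ 2 * (∑ p ∈ k.primeFactors, Real.log p ^ 4) +
          448 * (∑ p ∈ k.primeFactors, Real.log p ^ 2) * (∑ p ∈ k.primeFactors, Real.log p ^ 6) +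
            140 * (∑ p ∈ k.primeFactors, Real.log p ^ 4) ^ 2 - 272 * ∑ p ∈ k.primeFactors, Real.log p ^ 8) =
      (if k.Coprime n then W k else 0) * ∑ x ∈ k.divisorsAntidiagonal, (Real.log x.1 - Real.log x.2) ^ 8 := by
  by_cases hk : Squarefree k
  · rw [copTauW_apply, (sum_divisorsAntidiagonal_log_sub_pow_six_eight_of_squarefree k hk).2.2.2]
    split_ifs <;> ring
  · rw [copTauW_apply, W_eq_zero_of_not_squarefree hk]
    split_ifs <;> simp

end Summit.Parity.GeneralizedHardyLittlewood.Theorems.MomentsBeyondDiagonal.DiagCorner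

end
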